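import Summits.AtomisticToContinuum.Crystallization.Theorems.HullExactificationCascadeRobustBarlowTemplateTransportSteps1
import Summits.AtomisticToContinuum.Crystallization.Theorems.HullExactificationCascadeRobustBarlowTemplateTransportSteps2
import Summits.AtomisticToContinuum.Crystallization.Theorems.HullExactificationCascadeRobustBarlowTemplateTransportSteps6
import Summits.AtomisticToContinuum.Crystallization.Theorems.PalmUnimodularRigidityShellsToBarlowChartTransportAttach1

/-!
# Line `registered` (crux `RobustBarlowTemplate`, stmt-AtomisticToContinuum-12088): swap symmetry and the attachment of transported caps (part 1/2)

Helper lemmas for `develop_transport` (the geometric half of the development): frames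
`⟨x, t₁, t₂, U⟩` read in the scale-relative integer charts `IsZChart` of an everywhere-good
configuration, their transports and the coherence of the resulting development `frameAt`.  The
only metric inputs are the chart transfer lemma `develop_transfer` and `bond_nb_iff`; everything
else is label combinatorics in `ℤ³` (pattern facts `TransportPatterns*` of the sibling crux 9227,
imported verbatim).  All `[folklore]` (HalesDSP2012 §1.3 for the two kissing patterns).

PORT of `PalmUnimodularRigidityShellsToBarlowChartTransportAttach1.lean` of the closed sibling
crux `ShellsToBarlowChart` (stmt-9227) to the SCALE-RELATIVE shell relation `y ∈ shell S x` of
this crux (in place of the bond window `0 < dist x y ∧ dist x y ≤ 28/25`) and to the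
five-argument charts `IsZChart S x P A nbr`; the port rules (conjunct paths,
`bond a b ↦ b ∈ shell S a`, the threaded symmetry hypothesis
`hsy : ∀ x ∈ S, ∀ y ∈ shell S x, x ∈ shell S y` replacing `bond_symm`, `zchart_transfer` /
`zchart_sqNormInt_eq` replacing `sqNormInt_transfer` / `IsZChart.sqNormInt_eq`, the
`open … hiding …` line) are listed under "Port notes" in `…RobustBarlowTemplateTransportSteps1.lean`
(and its extension in `…RobustBarlowTemplateTransportSteps6.lean`).

## Port notes (this part: `TransportAttach1`)
* the seventeen CHART-AGNOSTIC lemmas of the source part (`hexLabels_comm`, `capWithAny_comm`,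
  `capWith_comm`, `capOpp_comm`, `lowerCap_comm`, `isFrame_swap`, `frameParity_swap`,
  `lowerParity_swap`, `apexOf_swap`, `Jstep_swap`, `JinvStep_swap`, `Vstep_swap`, `VinvStep_swap`,
  `even_form_of_parity`, `odd_form_of_parity`, `pos_form_of_lowerParity`,
  `neg_form_of_lowerParity`: pure `ℤ³` / `OpsDefs` statements, no chart hypothesis) are NOT
  re-proved (the gate forbids restating landed declarations): they are used from the source module
  `…ShellsToBarlowChartTransportAttach1`, imported for that purpose — together with, through it,
  the chart-agnostic `apexOf_eq_of_form` (9227 `Steps6`) and `lowerCap_cases`,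
  `isFrame_lowerCap` (9227 `Vinv`); only the two chart-dependent lemmas `attach_I_even`,
  `attach_I_odd` are ported, with `hsy` inserted right after `hch` (their proofs call
  `Istep_spec`); the proofs are the source proofs verbatim up to the rules (no bond and no metric
  constant occurs in this part);
* imports: our parts 1, 2, 6 (the source imports its parts 1, 2, 6 and `Vinv`; nothing of `Vinv`
  beyond the two chart-agnostic lemmas above is used here, so our `…TransportVinv` is not
  imported); since the 9227 import makes the 9227 parts 1–7, `Lower`, `Vinv`, `Attach1` visible,
  the `open … hiding …` line of part 6 is EXTENDED by the chart-dependent 9227 names redeclared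
  (or to be redeclared) in our parts `Lower`, `Steps7`, `Vinv`, `Attach1` (`nb_inj`, `Istep_lower`,
  `Jstep_lower`, `IinvStep_lower`, `JinvStep_lower`, `Vstep_spec`, `polar_at_lower_apex`,
  `onesided_at_lower_apex`, `VinvStep_spec`, `attach_I_even`, `attach_I_odd`) — inside this
  namespace our declarations take precedence anyway; copy this longer line into later parts;
* the anchor at the end (explicit-`∀` form, registered sub-goal) is new.
-/

noncomputable section

namespace Summit.AtomisticToContinuum.Crystallization.Theorems.HullExactificationCascadeRobustBarlowTemplate

open Literature.Geometry.DiscreteGeometry Literature.MathematicalPhysics.StatisticalMechanics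
open Summit.AtomisticToContinuum.Crystallization.Theorems.PalmUnimodularRigidityShellsToBarlowChart hiding
  IsZChart TransportSystem scales_tied sqNormInt_transfer bond_symm nb_mem zlab_spec zlab_nb bond_nb_iff
  pattern_cases transfer_nb_nb transfer_nb_centre transfer_nb_target sqNormInt_zlab_centre hcp_of_mirror_pair
  Istep_spec Jstep_spec IinvStep_spec JinvStep_spec capWithAny_of_mem_cap IinvStep_Istep Istep_IinvStep
  JinvStep_Jstep Jstep_JinvStep polar_at_apex onesided_at_apex nb_inj Istep_lower Jstep_lower
  IinvStep_lower JinvStep_lower Vstep_spec polar_at_lower_apex onesided_at_lower_apex VinvStep_spec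
  attach_I_even attach_I_odd

variable {S : Set (EuclideanSpace ℝ (Fin 3))} {Pc : (EuclideanSpace ℝ (Fin 3)) → Finset (Fin 3 → ℤ)}
  {Ac : (EuclideanSpace ℝ (Fin 3)) → ((EuclideanSpace ℝ (Fin 3)) →ₗᵢ[ℝ] (EuclideanSpace ℝ (Fin 3)))}
  {nb : (EuclideanSpace ℝ (Fin 3)) → (Fin 3 → ℤ) → (EuclideanSpace ℝ (Fin 3))}

/-- **Upper attachment across I, even layer**: the apex site `nb x c` of an even frame is the
neighbour of `Ix` labelled `c₊ − t₁₊` (`c₊` the apex of the transported cap): in the model,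
`(k+1, i, j)` is the upper neighbour of `(k, i+1, j)` with offset `(1, 0)`. [folklore] -/
theorem attach_I_even (hch : ∀ z ∈ S, IsZChart S z (Pc z) (Ac z) (nb z))
    (hsy : ∀ x ∈ S, ∀ y ∈ shell S x, x ∈ shell S y) {x : (EuclideanSpace ℝ (Fin 3))}
    (hx : x ∈ S) {t₁ t₂ : Fin 3 → ℤ} {U : Finset (Fin 3 → ℤ)} (hU : IsFrame (Pc x) t₁ t₂ U)
    (hpar : frameParity t₁ t₂ U = 1)
    (hreg : Pc (nb x t₁) = fcc3Int ∨ Pc x = hcpInt ∨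
      (-zlab Pc nb (nb x t₁) x ∈ Pc (nb x t₁) ∧ -zlab Pc nb (nb x t₁) (nb x t₂) ∈ Pc (nb x t₁))) :
    nb (nb x t₁) (apexOf (Istep Pc nb ⟨x, t₁, t₂, U⟩).t₁ (Istep Pc nb ⟨x, t₁, t₂, U⟩).t₂
        (Istep Pc nb ⟨x, t₁, t₂, U⟩).U - (Istep Pc nb ⟨x, t₁, t₂, U⟩).t₁) = nb x (apexOf t₁ t₂ U) ∧
    zlab Pc nb (nb x t₁) (nb x (apexOf t₁ t₂ U)) =
      apexOf (Istep Pc nb ⟨x, t₁, t₂, U⟩).t₁ (Istep Pc nb ⟨x, t₁, t₂, U⟩).t₂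
        (Istep Pc nb ⟨x, t₁, t₂, U⟩).U - (Istep Pc nb ⟨x, t₁, t₂, U⟩).t₁ := by
  obtain ⟨hyS, -, -, -, -, -, -, -, -, -, -, hframe, hparI, c₁, hc₁U, -, hfilt, hbu, -, -, hfiltU⟩ :=
    Istep_spec hch hsy hx hU hreg
  have hPx := pattern_cases hch hx
  have hPy := pattern_cases hch hyS
  obtain ⟨h12, hhex, -, -, -⟩ := id hU
  have ht₁ : t₁ ∈ Pc x := hhex (mem_hexLabels_iff.2 (Or.inl rfl))
  have ht₂ : t₂ ∈ Pc x := hhex (mem_hexLabels_iff.2 (Or.inr (Or.inl rfl)))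
  obtain ⟨hcU, hcP, hc, hc1, hc2, hE⟩ := even_form_of_parity hPx hU hpar
  set c := apexOf t₁ t₂ U with hc_def
  have hc₁ : c₁ = c := by
    have h1 := (filter_evenCap (Pc x) hPx t₁ ht₁ t₂ ht₂ c hcP h12 hhex hc hc1 hc2).1
    rw [← hE, hfilt] at h1
    exact Finset.singleton_injective h1
  rw [hc₁] at hbu hfiltU
  have hμ := zlab_spec hch hyS (nb_mem hch hx hcP).1 hbu
  -- the transported cap is even with apex `c'`
  have hpar' := hparI.trans hpar
  set a' := (Istep Pc nb ⟨x, t₁, t₂, U⟩).t₁ with ha'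
  set b' := (Istep Pc nb ⟨x, t₁, t₂, U⟩).t₂ with hb'
  set U' := (Istep Pc nb ⟨x, t₁, t₂, U⟩).U with hU'
  obtain ⟨h12', hhex', -, -, -⟩ := id hframe
  have ha'P : a' ∈ Pc (nb x t₁) := hhex' (mem_hexLabels_iff.2 (Or.inl rfl))
  have hb'P : b' ∈ Pc (nb x t₁) := hhex' (mem_hexLabels_iff.2 (Or.inr (Or.inl rfl)))
  obtain ⟨-, hc'P, hc', hc1', hc2', hE'⟩ := even_form_of_parity hPy hframe hpar'
  set c' := apexOf a' b' U' with hc'_def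
  have hμeq : zlab Pc nb (nb x t₁) (nb x c) = c' - a' := by
    have h1 := (filter_evenCap (Pc (nb x t₁)) hPy a' ha'P b' hb'P c' hc'P h12' hhex' hc' hc1' hc2').2.2.1
    rw [← hE', hfiltU] at h1
    exact Finset.singleton_injective h1
  refine ⟨?_, hμeq⟩
  rw [← hμeq]; exact hμ.2

/-- **Upper attachment across I, odd layer**: the apex site of `Ix` is the neighbour of `x`
labelled `c + t₁`: in the model, `(k+1, i+1, j)` is an upper neighbour of `(k, i, j)`.
[folklore] -/
theorem attach_I_odd (hch : ∀ z ∈ S, IsZChart S z (Pc z) (Ac z) (nb z))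
    (hsy : ∀ x ∈ S, ∀ y ∈ shell S x, x ∈ shell S y) {x : (EuclideanSpace ℝ (Fin 3))}
    (hx : x ∈ S) {t₁ t₂ : Fin 3 → ℤ} {U : Finset (Fin 3 → ℤ)} (hU : IsFrame (Pc x) t₁ t₂ U)
    (hpar : frameParity t₁ t₂ U = -1)
    (hreg : Pc (nb x t₁) = fcc3Int ∨ Pc x = hcpInt ∨
      (-zlab Pc nb (nb x t₁) x ∈ Pc (nb x t₁) ∧ -zlab Pc nb (nb x t₁) (nb x t₂) ∈ Pc (nb x t₁))) :
    nb (nb x t₁) (apexOf (Istep Pc nb ⟨x, t₁, t₂, U⟩).t₁ (Istep Pc nb ⟨x, t₁, t₂, U⟩).t₂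
        (Istep Pc nb ⟨x, t₁, t₂, U⟩).U) = nb x (apexOf t₁ t₂ U + t₁) ∧
    zlab Pc nb (nb x t₁) (nb x (apexOf t₁ t₂ U + t₁)) =
      apexOf (Istep Pc nb ⟨x, t₁, t₂, U⟩).t₁ (Istep Pc nb ⟨x, t₁, t₂, U⟩).t₂
        (Istep Pc nb ⟨x, t₁, t₂, U⟩).U := by
  obtain ⟨hyS, -, -, -, -, -, -, -, -, -, -, hframe, hparI, c₁, hc₁U, -, hfilt, hbu, -, -, hfiltU⟩ :=
    Istep_spec hch hsy hx hU hreg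
  have hPx := pattern_cases hch hx
  have hPy := pattern_cases hch hyS
  obtain ⟨h12, hhex, -, -, -⟩ := id hU
  have ht₁ : t₁ ∈ Pc x := hhex (mem_hexLabels_iff.2 (Or.inl rfl))
  have ht₂ : t₂ ∈ Pc x := hhex (mem_hexLabels_iff.2 (Or.inr (Or.inl rfl)))
  obtain ⟨hcU, hcP, hc, hc1, hc2, hO⟩ := odd_form_of_parity hPx hU hpar
  set c := apexOf t₁ t₂ U with hc_def
  have hc₁ : c₁ = c + t₁ := by
    have h1 := (filter_oddCap (Pc x) hPx t₁ ht₁ t₂ ht₂ c hcP h12 hhex hc hc1 hc2).1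
    rw [← hO, hfilt] at h1
    exact Finset.singleton_injective h1
  rw [hc₁] at hbu hfiltU
  have hμ := zlab_spec hch hyS (nb_mem hch hx hc1).1 hbu
  have hpar' := hparI.trans hpar
  set a' := (Istep Pc nb ⟨x, t₁, t₂, U⟩).t₁ with ha'
  set b' := (Istep Pc nb ⟨x, t₁, t₂, U⟩).t₂ with hb'
  set U' := (Istep Pc nb ⟨x, t₁, t₂, U⟩).U with hU'
  obtain ⟨h12', hhex', -, -, -⟩ := id hframe
  have ha'P : a' ∈ Pc (nb x t₁) := hhex' (mem_hexLabels_iff.2 (Or.inl rfl))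
  have hb'P : b' ∈ Pc (nb x t₁) := hhex' (mem_hexLabels_iff.2 (Or.inr (Or.inl rfl)))
  obtain ⟨-, hc'P, hc', hc1', hc2', hO'⟩ := odd_form_of_parity hPy hframe hpar'
  set c' := apexOf a' b' U' with hc'_def
  have hμeq : zlab Pc nb (nb x t₁) (nb x (c + t₁)) = c' := by
    have h1 := (filter_oddCap (Pc (nb x t₁)) hPy a' ha'P b' hb'P c' hc'P h12' hhex' hc' hc1' hc2').2.2.1
    rw [← hO', hfiltU] at h1
    exact Finset.singleton_injective h1
  refine ⟨?_, hμeq⟩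
  rw [← hμeq]; exact hμ.2

/-! ## Anchor -/

/-- Anchor (registered sub-goal of stmt-AtomisticToContinuum-12088, toward `develop_transport`):
upper attachment across `I` on an odd layer — the apex site of the transported frame `Ix` is the
neighbour of `x` labelled `apexOf t₁ t₂ U + t₁` (explicit form of the first conjunct of
`attach_I_odd`, basic regime). [folklore] -/
theorem transportAttach1_anchor : ∀ (S : Set (EuclideanSpace ℝ (Fin 3))) (Pc : EuclideanSpace ℝ (Fin 3) → Finset (Fin 3 → ℤ)) (Ac : EuclideanSpace ℝ (Fin 3) → (EuclideanSpace ℝ (Fin 3) →ₗᵢ[ℝ] EuclideanSpace ℝ (Fin 3))) (nb : EuclideanSpace ℝ (Fin 3) → (Fin 3 → ℤ) → EuclideanSpace ℝ (Fin 3)), (∀ z ∈ S, IsZChart S z (Pc z) (Ac z) (nb z)) → (∀ x ∈ S, ∀ y ∈ shell S x, x ∈ shell S y) → ∀ x ∈ S, ∀ (t₁ t₂ : Fin 3 → ℤ) (U : Finset (Fin 3 → ℤ)), IsFrame (Pc x) t₁ t₂ U → frameParity t₁ t₂ U = -1 → (Pc (nb x t₁) = fcc3Int ∨ Pc x = hcpInt)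 → nb (nb x t₁) (apexOf (Istep Pc nb ⟨x, t₁, t₂, U⟩).t₁ (Istep Pc nb ⟨x, t₁, t₂, U⟩).t₂ (Istep Pc nb ⟨x, t₁, t₂, U⟩).U) = nb x (apexOf t₁ t₂ U + t₁) := by
  intro S Pc Ac nb hch hsy x hx t₁ t₂ U hU hpar hreg
  have hreg' : Pc (nb x t₁) = fcc3Int ∨ Pc x = hcpInt ∨
      (-zlab Pc nb (nb x t₁) x ∈ Pc (nb x t₁) ∧ -zlab Pc nb (nb x t₁) (nb x t₂) ∈ Pc (nb x t₁)) := by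
    rcases hreg with h | h
    · exact Or.inl h
    · exact Or.inr (Or.inl h)
  exact (attach_I_odd hch hsy hx hU hpar hreg').1

end Summit.AtomisticToContinuum.Crystallization.Theorems.HullExactificationCascadeRobustBarlowTemplate

end
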